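import Summits.HodgeConjecture.HodgeConjecture.Theorems.K2E1SelfDualResidueAtomMemCharLineCMTwo          -- ★ p861962 (this seat, PART 1): `mem_lineSubrep_inv_of_ae_eq`, `mem_iSup_charLine₂_of_ae_eq{,_residue}`, `span_le_iSup_charLine₂_of_forall_ae_eq`
import Summits.HodgeConjecture.HodgeConjecture.Theorems.K2E1EisensteinResidueLevelConstantU2Final          -- ★ p861902 (R90-CS-p03): T2 FINAL `residue_detTwist_eq_const_mul_level_cm_two`
import Summits.HodgeConjecture.HodgeConjecture.Theorems.K2E1ChiDetCharTorusDescentU2                      -- ★ p861677 (K2E1-p10): `isChiSection_one_detChar_inv_mul`, `cm_exists_cmDetChar_borel_eq_two`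
import HarnessLib

/-!
# K2·E1 ∕ R90·S8 — `K2E1SelfDualResidueClassMemCharLineOfLettersCMTwo`: THE PER-BLOCK PAYMENT OF THE (L-SD) LETTER IN T2'S CURRENCY —
# a residue class of a `det`-twisted level Eisenstein family of `U(1,1)_{L∕L⁺}` at the top pole lies in `⨆_ψ ℂ·[ψ∘det]`; both spellings of the datum; the section dictionary

Track B ∕ K2-LIT, crux h413 = `stmt-HodgeConjecture-24833`, route of record `HCCMUnconditional`; cell `hodgecm-mathlib`, R90-TF section S8 «ContSpec-n½» (R90-CS-plan (g0) deal (B)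
→ K2E2-p12 (g8); PART 2 per the rulings 16:30:13Z: `At := span of residue classes` (S8-R14 ∕ LEAD #25 (3)); level = T2 FINAL's `(K′_f, K_∞-spherical)` blocks, stated PER BLOCK for
LAYER 2's `ω = 1` slice (K2E1-p15 (g3) `R90S8ResHLeClosureCharLinesOfLetters`)).  THEOREMS ONLY (no `def`, no `instance`, no notation, no named-fact hypothesis, no `sorry`; default
heartbeats); lane `--supports stmt-HodgeConjecture-24833 --as helper` (count-neutral).

THE MATHEMATICS ([MoeglinWaldspurger1995, IV.1.11]; [Rogawski1990, §13.9 (i) p. 229, §13.3 p. 202]; [Gelbart1975, §2.A]).  T2 FINAL (★ p861902 `residue_detTwist_eq_const_mul_level_cm_two`): for a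
continued Borel Eisenstein family `Ẽ(z)` of `U(J₂)` attached to a continuous bounded section `φ₁` of the TRIVIAL datum at any level, and a unitary automorphic character `Θ` (e.g. `ψ∘det`),
the pointwise residue of the twisted family `Ẽ(z)·Θ` at `z = 1` is `g ↦ r·Θ(g)`.  Read in `L²` through the `out⁻¹` convention of the E1 estate (`Res =ᵐ x ↦ Fp′ (out x)⁻¹ 1`), PART 1
(★ p861962) places that class on the character line of `Θ⁻¹ = ψ′∘det`, i.e. in `⨆_ψ ℂ·[ψ∘det]` — the lattice of the S8 socket #4′ `sock_S8_resH_spannedByCharLines`.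
* §1 BOTH SPELLINGS OF THE DATUM.  The E1 chain lives on Mok's `quasiSplit L⁺ L c 2 = cmDatum L 2 ((antidiagonal 2).over L)` (`rfl`), the #4′ lattice on `cmDatum L 2 Φ₂` with the LITERAL
  `Φ₂ = (i,j) ↦ [i+j+1 = 2]` (★ `antidiagOne_eq_over`, propositional): **`mem_iSup_lineSubrep_cmDetChar_of_ae_eq`** for ANY `Φ = (antidiagonal 2).over L` (★
  `cm_exists_eq_cmDetChar_of_eq_antidiagonal_two`), its `quasiSplit` print `…_quasiSplit_…`, and the residue-shape variants.
* §2 **`residueClass_mem_iSup_lineSubrep_of_levelLetters_cm_two`** — THE PER-BLOCK PAYMENT: T2 FINAL's binders VERBATIM + `(f : L²) (hf : ⇑f =ᵐ x ↦ Fp′ (out x)⁻¹ 1)` ⊢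
  `f ∈ ⨆ ψ : {ψ ∕∕ automorphic}, (lineSubrep (cmDetChar L 2 ((antidiagonal 2).over L) ψ.1 ψ.2 _) μ).toSubmodule` — LAYER 2 feeds these memberships to PART 1's `span_le_iSup_charLine₂_of_forall_ae_eq` (letter (L)).
* §3 THE SECTION DICTIONARY for `χ = (χ̃_ψ)⁻¹` (`χ₀ = 1`, ★ p861677): `φ ∈ V(χ, K′, ω)` ⇒ `φ₁ := Θ⁻¹·φ` is a section of the TRIVIAL datum with T2's letters `hφN` (left-`N(𝔸)`), `hφB`
  (left-`B(L⁺)`), continuity and the bound `‖φ₁‖ ≤ M` inherited from `φ` (`|Θ| = 1`) — **`trivialDatum_letters_of_chiSection_detTwist`**.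
WHAT STAYS A LETTER (honest): T2 FINAL's own binders (the block's continued family `Ec` with `hE2`∕`hE3`, the scattering-residue letter `(ψ) {r} (hψ)` = J2 §3 `tendsto_sub_one_mul_qc` modulo
the one-source letter `hsrc` (J2′, K2E1-p10), the pole letters `Fp, Fp′` and the `L²` family `Fam, Res`); the identification «LAYER 2's `χ`-block family = the `Θ`-twist of a trivial-datum family»
is ★ R5 `K2E1ChiEisensteinDetTwistU2.eq_eisensteinSeriesU_flatSectionU_twist` ∕ `pole_letter_twist` read by LAYER 2 at its own bytes.
HONEST LABEL: HC_CM is proved only modulo the 7 printed citations (2 remaining named inputs: hLiu418 = `stmt-HodgeConjecture-24832`, h413 = `stmt-HodgeConjecture-24833`) until rung 0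
closes; count-neutral helper; closes no socket.

## References
* [MoeglinWaldspurger1995] C. Mœglin, J.-L. Waldspurger, *Spectral Decomposition and Eisenstein Series* (1995), IV.1.11.
* [Rogawski1990] J. D. Rogawski, *Automorphic Representations of Unitary Groups in Three Variables* (1990), §13.3 p. 202, §13.9 (i) p. 229.
* [Gelbart1975] S. Gelbart, *Automorphic forms on adele groups* (1975), §2.A.
-/

set_option autoImplicit false
-- the mandated namespace repeats the single-problem summit's segment (`HodgeConjecture.HodgeConjecture`)
set_option linter.dupNamespace false

noncomputable section

open MeasureTheory Measure NumberField IsDedekindDomain Set Filter Topology Metric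
open scoped ENNReal NNReal
open Literature.NumberTheory.Automorphic Literature.NumberTheory.Automorphic.UnitaryGroup AdelicGroupData
open Literature.NumberTheory.Automorphic.Arthur2013.Leaves.TECR
open Literature.NumberTheory.GaloisRepresentations (HeckeCharacter)
open Summit.HodgeConjecture.HodgeConjecture.Cruxes.H413.K2E1BorelEisensteinU
open Summit.HodgeConjecture.HodgeConjecture.Cruxes.H413.K2E1BLBorelSpacesU2Defs
open Summit.HodgeConjecture.HodgeConjecture.Cruxes.H413.K2E1CharacterEisensteinU2Defs
open Summit.HodgeConjecture.HodgeConjecture.Cruxes.H413.K2E1ChiSectionSpaceU2Defs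
open Summit.HodgeConjecture.HodgeConjecture.Cruxes.H413.K2E1SelfDualResidueAtomMemCharLineCMTwo (mem_lineSubrep_inv_of_ae_eq)
open Summit.HodgeConjecture.HodgeConjecture.Cruxes.H413.K2E1EisensteinResidueLevelConstantU2Final (residue_detTwist_eq_const_mul_level_cm_two)
open Summit.HodgeConjecture.HodgeConjecture.Cruxes.H413.K2E1ChiDetCharTorusDescentU2 (isChiSection_one_detChar_inv_mul)

namespace Summit.HodgeConjecture.HodgeConjecture.Cruxes.H413.K2E1SelfDualResidueClassMemCharLineOfLettersCMTwo

variable (L : Type) [Field L] [NumberField L] [IsCMField L]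

/-! ## §1 Both spellings of the datum: an `L²` class a.e. `x ↦ r·Θ((out x)⁻¹)` lies in `⨆_ψ ℂ·[ψ∘det]` -/

section Spellings

/-- **ANY `Φ = (antidiagonal 2).over L`**: an `L²` class on the automorphic quotient of `U(Φ)(𝔸_{L⁺})` a.e. equal to `x ↦ r·Θ((out x)⁻¹)`, `Θ` any automorphic character, lies in
`⨆ ψ : {ψ ∕∕ automorphic}, ℂ·[ψ∘det]` (`Θ⁻¹ = ψ′∘det`, ★ `cm_exists_eq_cmDetChar_of_eq_antidiagonal_two`; PART 1 ★ `mem_lineSubrep_inv_of_ae_eq`). [cite: Rogawski1990, §13.3 p. 202] [cite: Gelbart1975, §2.A] -/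
theorem mem_iSup_lineSubrep_cmDetChar_of_ae_eq (Φ : Matrix (Fin 2) (Fin 2) L) (hΦ : Φ = (StdForm.antidiagonal 2).over L) (hΦd : Φ.det ≠ 0)
    (μ : Measure (adelicGroupData ↥(maximalRealSubfield L) L (IsCMField.complexConj L) 2 Φ).automorphicQuotient)
    [(adelicGroupData ↥(maximalRealSubfield L) L (IsCMField.complexConj L) 2 Φ).IsAutomorphicMeasure μ]
    (Θ : (adelicGroupData ↥(maximalRealSubfield L) L (IsCMField.complexConj L) 2 Φ).AutomorphicCharacter) (r : ℂ)
    {f : (adelicGroupData ↥(maximalRealSubfield L) L (IsCMField.complexConj L) 2 Φ).L2 μ}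
    (hf : (f : (adelicGroupData ↥(maximalRealSubfield L) L (IsCMField.complexConj L) 2 Φ).automorphicQuotient → ℂ) =ᵐ[μ]
      fun x => r * ((Θ (Quotient.out (x : (adelicGroupData ↥(maximalRealSubfield L) L (IsCMField.complexConj L) 2 Φ).Adelic ⧸
        (adelicGroupData ↥(maximalRealSubfield L) L (IsCMField.complexConj L) 2 Φ).quotientSubgroup))⁻¹ : ℂˣ) : ℂ)) :
    f ∈ ⨆ ψ : {ψ : ↥(TorusDict.torus (IsCMField.complexConj L)) →ₜ* ℂˣ // TorusDict.IsAutomorphic (IsCMField.complexConj L) ψ},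
      (AdelicGroupData.AutomorphicCharacter.lineSubrep (cmDetChar L 2 Φ ψ.1 ψ.2 hΦd) μ).toSubmodule := by
  obtain ⟨θ, hθ, hΘθ⟩ := cm_exists_eq_cmDetChar_of_eq_antidiagonal_two L Φ hΦ hΦd Θ⁻¹
  have hmem : f ∈ (AdelicGroupData.AutomorphicCharacter.lineSubrep (cmDetChar L 2 Φ θ hθ hΦd) μ).toSubmodule := by
    rw [hΘθ]
    exact mem_lineSubrep_inv_of_ae_eq Θ μ r hf
  exact Submodule.mem_iSup_of_mem ⟨θ, hθ⟩ hmem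

/-- **`quasiSplit` PRINT** (`quasiSplit L⁺ L c 2 = cmDatum L 2 ((antidiagonal 2).over L)`, `rfl`): the same on Mok's datum, where the E1 Eisenstein chain lives.
[cite: Rogawski1990, §13.3 p. 202] [cite: Gelbart1975, §2.A] -/
theorem mem_iSup_lineSubrep_cmDetChar_quasiSplit_of_ae_eq
    (μ : Measure (quasiSplit (↥(maximalRealSubfield L)) L (IsCMField.complexConj L) 2).automorphicQuotient) [(quasiSplit (↥(maximalRealSubfield L)) L (IsCMField.complexConj L) 2).IsAutomorphicMeasure μ]
    (Θ : (quasiSplit (↥(maximalRealSubfield L)) L (IsCMField.complexConj L) 2).AutomorphicCharacter) (r : ℂ) {f : (quasiSplit (↥(maximalRealSubfield L)) L (IsCMField.complexConj L) 2).L2 μ}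
    (hf : (f : (quasiSplit (↥(maximalRealSubfield L)) L (IsCMField.complexConj L) 2).automorphicQuotient → ℂ) =ᵐ[μ]
      fun x => r * ((Θ (Quotient.out (x : (quasiSplit (↥(maximalRealSubfield L)) L (IsCMField.complexConj L) 2).Adelic ⧸ (quasiSplit (↥(maximalRealSubfield L)) L (IsCMField.complexConj L) 2).quotientSubgroup))⁻¹ : ℂˣ) : ℂ)) :
    f ∈ ⨆ ψ : {ψ : ↥(TorusDict.torus (IsCMField.complexConj L)) →ₜ* ℂˣ // TorusDict.IsAutomorphic (IsCMField.complexConj L) ψ},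
      (AdelicGroupData.AutomorphicCharacter.lineSubrep (𝒢 := (quasiSplit (↥(maximalRealSubfield L)) L (IsCMField.complexConj L) 2))
        (cmDetChar L 2 ((StdForm.antidiagonal 2).over L) ψ.1 ψ.2 ((Matrix.isUnit_iff_isUnit_det _).mp (StdForm.isUnit_over (StdForm.antidiagonal 2) L)).ne_zero) μ).toSubmodule :=
  mem_iSup_lineSubrep_cmDetChar_of_ae_eq L ((StdForm.antidiagonal 2).over L) rfl _ μ Θ r hf

/-- **`quasiSplit` PRINT, POINTWISE-RESIDUE SHAPE**: `hres : ∀ g, F g = r * Θ g` (T2 FINAL's conclusion) and `hf : ⇑f =ᵐ x ↦ F((out x)⁻¹)` (the (L-AE) identification) give the membership.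
[cite: MoeglinWaldspurger1995, IV.1.11] [cite: Rogawski1990, §13.3 p. 202] -/
theorem mem_iSup_lineSubrep_cmDetChar_quasiSplit_of_ae_eq_residue
    (μ : Measure (quasiSplit (↥(maximalRealSubfield L)) L (IsCMField.complexConj L) 2).automorphicQuotient) [(quasiSplit (↥(maximalRealSubfield L)) L (IsCMField.complexConj L) 2).IsAutomorphicMeasure μ]
    (Θ : (quasiSplit (↥(maximalRealSubfield L)) L (IsCMField.complexConj L) 2).AutomorphicCharacter) {F : (quasiSplit (↥(maximalRealSubfield L)) L (IsCMField.complexConj L) 2).Adelic → ℂ} {r : ℂ} (hres : ∀ g, F g = r * ((Θ g : ℂˣ) : ℂ))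
    {f : (quasiSplit (↥(maximalRealSubfield L)) L (IsCMField.complexConj L) 2).L2 μ}
    (hf : (f : (quasiSplit (↥(maximalRealSubfield L)) L (IsCMField.complexConj L) 2).automorphicQuotient → ℂ) =ᵐ[μ] fun x => F (Quotient.out (x : (quasiSplit (↥(maximalRealSubfield L)) L (IsCMField.complexConj L) 2).Adelic ⧸ (quasiSplit (↥(maximalRealSubfield L)) L (IsCMField.complexConj L) 2).quotientSubgroup))⁻¹) :
    f ∈ ⨆ ψ : {ψ : ↥(TorusDict.torus (IsCMField.complexConj L)) →ₜ* ℂˣ // TorusDict.IsAutomorphic (IsCMField.complexConj L) ψ},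
      (AdelicGroupData.AutomorphicCharacter.lineSubrep (𝒢 := (quasiSplit (↥(maximalRealSubfield L)) L (IsCMField.complexConj L) 2))
        (cmDetChar L 2 ((StdForm.antidiagonal 2).over L) ψ.1 ψ.2 ((Matrix.isUnit_iff_isUnit_det _).mp (StdForm.isUnit_over (StdForm.antidiagonal 2) L)).ne_zero) μ).toSubmodule :=
  mem_iSup_lineSubrep_cmDetChar_quasiSplit_of_ae_eq L μ Θ r (hf.trans (Filter.Eventually.of_forall fun _ => hres _))

end Spellings

/-! ## §2 THE PER-BLOCK PAYMENT in T2 FINAL's currency -/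

section Payment

variable [MeasurableSpace (quasiSplit (↥(maximalRealSubfield L)) L (IsCMField.complexConj L) 2).Adelic] [BorelSpace (quasiSplit (↥(maximalRealSubfield L)) L (IsCMField.complexConj L) 2).Adelic]
  (μ : Measure (quasiSplit (↥(maximalRealSubfield L)) L (IsCMField.complexConj L) 2).automorphicQuotient) [(quasiSplit (↥(maximalRealSubfield L)) L (IsCMField.complexConj L) 2).IsAutomorphicMeasure μ]

/-- **THE RESIDUE CLASS OF A `det`-TWISTED LEVEL EISENSTEIN FAMILY OF `U(1,1)_{L∕L⁺}` AT `z = 1` LIES IN `⨆_ψ ℂ·[ψ∘det]`** — per block, T2 FINAL's binders VERBATIM (a continuous bounded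
section `φ₁` of the trivial datum at any level, its continued family `Ec` with constant-term shape `hE3` and scattering-residue letter `hψ`, the pole letters, the `L²` family) + a unitary automorphic
character `Θ`, a pole letter `(Fp′, hF′, hFE′)` of `Ẽ·Θ`, and an `L²` class `f =ᵐ x ↦ Fp′ (out x)⁻¹ 1` (the residue class of the twisted family in the E1 `out⁻¹` convention): then
`f ∈ ⨆ ψ : {ψ ∕∕ automorphic}, ℂ·[ψ∘det]` — T2 FINAL ★ `residue_detTwist_eq_const_mul_level_cm_two` (`Fp′ g 1 = r·Θ g`) ∘ §1. [cite: MoeglinWaldspurger1995, IV.1.11] [cite: Rogawski1990, §13.9 (i) p. 229] -/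
theorem residueClass_mem_iSup_lineSubrep_of_levelLetters_cm_two
    (ν : Measure ↥(adelicUnipotent (↥(maximalRealSubfield L)) L (IsCMField.complexConj L) 2)) [ν.IsHaarMeasure]
    {𝓕 : Set ↥(adelicUnipotent (↥(maximalRealSubfield L)) L (IsCMField.complexConj L) 2)}
    (h𝓕N : IsFundamentalDomain ↥(rationalUnipotent (↥(maximalRealSubfield L)) L (IsCMField.complexConj L) 2) 𝓕 ν) (h𝓕c : IsCompact (closure 𝓕))
    {φ₁ : (quasiSplit (↥(maximalRealSubfield L)) L (IsCMField.complexConj L) 2).Adelic → ℂ} (hφc : Continuous φ₁) {M : ℝ} (hφM : ∀ x, ‖φ₁ x‖ ≤ M)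
    (hφN : ∀ (u : ↥(adelicUnipotent (↥(maximalRealSubfield L)) L (IsCMField.complexConj L) 2)) (x : (quasiSplit (↥(maximalRealSubfield L)) L (IsCMField.complexConj L) 2).Adelic),
      φ₁ ((u : (quasiSplit (↥(maximalRealSubfield L)) L (IsCMField.complexConj L) 2).Adelic) * x) = φ₁ x)
    (hφB : ∀ b ∈ borelU ((IsCMField.complexConj L : L ≃ₐ[↥(maximalRealSubfield L)] L) : L →+* L) ((StdForm.antidiagonal 2).over L),
      ∀ x : (quasiSplit (↥(maximalRealSubfield L)) L (IsCMField.complexConj L) 2).Adelic,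
        φ₁ ((quasiSplit (↥(maximalRealSubfield L)) L (IsCMField.complexConj L) 2).toAdelic b * x) = φ₁ x)
    {T : ℝ≥0} (hT : 1 ≤ T)
    (Ec : ℂ → (quasiSplit (↥(maximalRealSubfield L)) L (IsCMField.complexConj L) 2).Adelic → ℂ) {D : Set ℂ} (hDo : IsOpen D) (hDc : IsPreconnected D)
    {σ₀ : ℝ} (hσ₀ : 1 < σ₀) (hσD : ∀ᶠ z in 𝓝 ((σ₀ : ℝ) : ℂ), z ∈ D) {ρ : ℝ} (hρ : 0 < ρ) (hρD : ∀ z : ℂ, z ≠ 1 → dist z 1 < ρ → z ∈ D)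
    (hEd : ∀ g, DifferentiableOn ℂ (fun z => Ec z g) D) (hE4 : ∀ z ∈ D, Continuous (Ec z))
    (hEbd : ∀ z₀ ∈ D, ∀ K : Set (quasiSplit (↥(maximalRealSubfield L)) L (IsCMField.complexConj L) 2).Adelic, IsCompact K → ∃ V ∈ 𝓝 z₀, ∃ M : ℝ, ∀ z ∈ V, ∀ g ∈ K, ‖Ec z g‖ ≤ M)
    (hEcinv : ∀ z ∈ D, ∀ (γ : (quasiSplit (↥(maximalRealSubfield L)) L (IsCMField.complexConj L) 2).arithmeticSubgroup) (x : (quasiSplit (↥(maximalRealSubfield L)) L (IsCMField.complexConj L) 2).Adelic),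
      Ec z ((γ : (quasiSplit (↥(maximalRealSubfield L)) L (IsCMField.complexConj L) 2).Adelic) * x) = Ec z x)
    (hE2 : ∀ z ∈ D, 1 < z.re → Ec z = eisensteinSeriesU (flatSectionU φ₁ z))
    (ψ : ℂ → (quasiSplit (↥(maximalRealSubfield L)) L (IsCMField.complexConj L) 2).Adelic → ℂ) {r : ℂ}
    (hψ : ∀ g : (quasiSplit (↥(maximalRealSubfield L)) L (IsCMField.complexConj L) 2).Adelic, Tendsto (fun z : ℂ => (z - 1) * ψ z g) (𝓝[≠] 1) (𝓝 r))
    (hE3 : ∀ z ∈ D, ∀ g : (quasiSplit (↥(maximalRealSubfield L)) L (IsCMField.complexConj L) 2).Adelic,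
      borelConstantTerm ν 𝓕 (Ec z) g = φ₁ g * (((borelHeight g : ℝ≥0) : ℝ) : ℂ) ^ z + ψ z g * (((borelHeight g : ℝ≥0) : ℝ) : ℂ) ^ (1 - z))
    (Fp : (quasiSplit (↥(maximalRealSubfield L)) L (IsCMField.complexConj L) 2).Adelic → ℂ → ℂ) (hF : ∀ g, AnalyticAt ℂ (Fp g) 1) (hFE : ∀ g, Fp g =ᶠ[𝓝[≠] 1] fun z => (z - 1) * Ec z g)
    (Fam : ℂ → (quasiSplit (↥(maximalRealSubfield L)) L (IsCMField.complexConj L) 2).L2 μ) (hFd : DifferentiableOn ℂ Fam D)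
    (hFam : ∀ z ∈ D, ((Fam z : (quasiSplit (↥(maximalRealSubfield L)) L (IsCMField.complexConj L) 2).L2 μ) : (quasiSplit (↥(maximalRealSubfield L)) L (IsCMField.complexConj L) 2).automorphicQuotient → ℂ) =ᵐ[μ]
      (quasiSplit (↥(maximalRealSubfield L)) L (IsCMField.complexConj L) 2).quotFun (truncation ν 𝓕 T (Ec z)))
    (Res : (quasiSplit (↥(maximalRealSubfield L)) L (IsCMField.complexConj L) 2).L2 μ) (hRes : Tendsto (fun z : ℂ => (z - 1) • Fam z) (𝓝[≠] 1) (𝓝 Res))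
    (Θ : (quasiSplit (↥(maximalRealSubfield L)) L (IsCMField.complexConj L) 2).AutomorphicCharacter)
    (Fp' : (quasiSplit (↥(maximalRealSubfield L)) L (IsCMField.complexConj L) 2).Adelic → ℂ → ℂ) (hF' : ∀ g, AnalyticAt ℂ (Fp' g) 1)
    (hFE' : ∀ g, Fp' g =ᶠ[𝓝[≠] 1] fun z => (z - 1) * (Ec z g * ((Θ g : ℂˣ) : ℂ)))
    (f : (quasiSplit (↥(maximalRealSubfield L)) L (IsCMField.complexConj L) 2).L2 μ)
    (hf : (f : (quasiSplit (↥(maximalRealSubfield L)) L (IsCMField.complexConj L) 2).automorphicQuotient → ℂ) =ᵐ[μ] fun x => Fp' (Quotient.out (x : (quasiSplit (↥(maximalRealSubfield L)) L (IsCMField.complexConj L) 2).Adelic ⧸ (quasiSplit (↥(maximalRealSubfield L)) L (IsCMField.complexConj L) 2).quotientSubgroup))⁻¹ 1) :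
    f ∈ ⨆ ψ' : {ψ' : ↥(TorusDict.torus (IsCMField.complexConj L)) →ₜ* ℂˣ // TorusDict.IsAutomorphic (IsCMField.complexConj L) ψ'},
      (AdelicGroupData.AutomorphicCharacter.lineSubrep (𝒢 := (quasiSplit (↥(maximalRealSubfield L)) L (IsCMField.complexConj L) 2))
        (cmDetChar L 2 ((StdForm.antidiagonal 2).over L) ψ'.1 ψ'.2 ((Matrix.isUnit_iff_isUnit_det _).mp (StdForm.isUnit_over (StdForm.antidiagonal 2) L)).ne_zero) μ).toSubmodule :=
  mem_iSup_lineSubrep_cmDetChar_quasiSplit_of_ae_eq_residue L μ Θ (F := fun g => Fp' g 1)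
    (residue_detTwist_eq_const_mul_level_cm_two L μ ν h𝓕N h𝓕c hφc hφM hφN hφB hT Ec hDo hDc hσ₀ hσD hρ hρD hEd hE4 hEbd hEcinv hE2 ψ hψ hE3 Fp hF hFE Fam hFd
      hFam Res hRes Θ Fp' hF' hFE') hf

end Payment

/-! ## §3 The section dictionary for `χ = (χ̃_ψ)⁻¹`: `φ₁ := (ψ∘det)⁻¹·φ` carries T2's section letters -/

section Dictionary

variable {K' : Subgroup (quasiSplit (↥(maximalRealSubfield L)) L (IsCMField.complexConj L) 2).Adelic} {ω : ↥K' → ℂ}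

/-- **THE SECTION DICTIONARY**: for an automorphic `ψ` of `U(1)_{L∕L⁺}(𝔸)`, `Θ = ψ∘det` (★ `cmDetChar`) and `χ = (χ̃_ψ)⁻¹` (so `χ₀ = 1`, ★ p861677), every `φ ∈ V(χ, K′, ω)` that is continuous and bounded
by `M` yields the trivial-datum section `φ₁ := Θ⁻¹·φ` with T2 FINAL's four section letters: `Continuous φ₁`, `‖φ₁ x‖ ≤ M` (`|Θ| = 1`), left-`N(𝔸)`-invariance (★ `IsChiSection.unipotent_mul` of the
`1`-section ★ `isChiSection_one_detChar_inv_mul`) and left-`B(L⁺)`-invariance (★ `IsChiSection.toAdelic_mul`); and `φ = Θ·φ₁`. [cite: Rogawski1990, §13.9 (i) p. 229] [cite: MoeglinWaldspurger1995, I.2.17] -/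
theorem trivialDatum_letters_of_chiSection_detTwist
    (ψ : ↥(TorusDict.torus (IsCMField.complexConj L)) →ₜ* ℂˣ) (hψ : TorusDict.IsAutomorphic (IsCMField.complexConj L) ψ)
    {φ : (quasiSplit (↥(maximalRealSubfield L)) L (IsCMField.complexConj L) 2).Adelic → ℂ}
    (hφ : φ ∈ chiSectionSpace (TorusDict.pullback (IsCMField.complexConj L) (Algebra.IsQuadraticExtension.finrank_eq_two _ L) (IsCMField.complexConj_ne_one L) ψ hψ)⁻¹ K' ω)
    (hφc : Continuous φ) {M : ℝ} (hφM : ∀ x, ‖φ x‖ ≤ M) :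
    ∃ φ₁ : (quasiSplit (↥(maximalRealSubfield L)) L (IsCMField.complexConj L) 2).Adelic → ℂ,
      (∀ g, φ g = ((cmDetChar L 2 ((StdForm.antidiagonal 2).over L) ψ hψ ((Matrix.isUnit_iff_isUnit_det _).mp (StdForm.isUnit_over (StdForm.antidiagonal 2) L)).ne_zero g : ℂˣ) : ℂ) * φ₁ g) ∧
      Continuous φ₁ ∧ (∀ x, ‖φ₁ x‖ ≤ M) ∧
      (∀ (u : ↥(adelicUnipotent (↥(maximalRealSubfield L)) L (IsCMField.complexConj L) 2)) (x : (quasiSplit (↥(maximalRealSubfield L)) L (IsCMField.complexConj L) 2).Adelic), φ₁ ((u : (quasiSplit (↥(maximalRealSubfield L)) L (IsCMField.complexConj L) 2).Adelic) * x) = φ₁ x) ∧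
      (∀ b ∈ borelU ((IsCMField.complexConj L : L ≃ₐ[↥(maximalRealSubfield L)] L) : L →+* L) ((StdForm.antidiagonal 2).over L), ∀ x : (quasiSplit (↥(maximalRealSubfield L)) L (IsCMField.complexConj L) 2).Adelic,
        φ₁ ((quasiSplit (↥(maximalRealSubfield L)) L (IsCMField.complexConj L) 2).toAdelic b * x) = φ₁ x) := by
  set Θ := cmDetChar L 2 ((StdForm.antidiagonal 2).over L) ψ hψ ((Matrix.isUnit_iff_isUnit_det _).mp (StdForm.isUnit_over (StdForm.antidiagonal 2) L)).ne_zero with hΘ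
  refine ⟨fun g => (((Θ g)⁻¹ : ℂˣ) : ℂ) * φ g, fun g => ?_, ?_, fun x => ?_, ?_, ?_⟩
  · rw [← mul_assoc, ← Units.val_mul, mul_inv_cancel, Units.val_one, one_mul]
  · -- `(Θ g)⁻¹ = Θ⁻¹ g` definitionally (★ `AutomorphicCharacter.inv_apply`)
    exact (Θ⁻¹.continuous.mul hφc :)
  · rw [norm_mul, Units.val_inv_eq_inv_val, norm_inv, Θ.norm_coe, inv_one, one_mul]
    exact hφM x
  · have h1 : IsChiSection (1 : HeckeCharacter L) fun g => (((Θ g)⁻¹ : ℂˣ) : ℂ) * φ g :=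
      isChiSection_one_detChar_inv_mul _ _ _ ψ hψ (isChiSection_of_mem hφ)
    exact fun u x => h1.unipotent_mul u x
  · have h1 : IsChiSection (1 : HeckeCharacter L) fun g => (((Θ g)⁻¹ : ℂˣ) : ℂ) * φ g :=
      isChiSection_one_detChar_inv_mul _ _ _ ψ hψ (isChiSection_of_mem hφ)
    exact h1.toAdelic_mul

end Dictionary

end Summit.HodgeConjecture.HodgeConjecture.Cruxes.H413.K2E1SelfDualResidueClassMemCharLineOfLettersCMTwo

end
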